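import Mathlib
import Literature.AlgebraicGeometry.Resolution.EtaleChartOfRoot
import Literature.AlgebraicGeometry.Resolution.EtaleChartNormal
import HarnessLib

/-!
# Galois splitting base, I: the roots of a monic polynomial with separable reduction

W4.4 (crux `NoZenoR`, stmt-ResolutionOfSingularities-19943), slot 5 `stub_L1wCoreF`, brick
**D2″ (Galois refinement of the splitting base)**, ring side, part 1 of 3. The (F1) descent of
minimality (BC-4 of the (L1)-PREP notes) needs a base change `S → Ŝ` of the normal surface germ
along which a finite GROUP acts transitively on the components of the pulled-back exceptional
curves; the one-root germ `S[X]/(f)` of D2′ is local-étale but not Galois. The refinement is the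
localisation `Ŝ = (S[α₁, …, αₙ])_𝔫` of the ring of ALL roots of `f` inside a splitting field,
with the stabiliser of `𝔫` in `Gal` acting. This file supplies the elementary algebra of the
ring of roots:

* `etale_adjoin_simpleRoots` — for an integrally closed domain `R` inside a field `L` and finitely
  many SIMPLE roots `θ` of `p ∈ R[X]`, the subalgebra `R[θ's, p′(θ)⁻¹'s] ⊆ L` is étale over `R`
  (iterate the tree's one-root chart `exists_etaleChart_of_root`; each chart is again an
  integrally closed domain by `isIntegrallyClosed_of_etale`);
* for `D` an integrally closed LOCAL domain, `f ∈ D[X]` monic, splitting in `L`, with separable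
  reduction `f̄`, and any `D`-subalgebra `S ⊆ L` integral over `D` containing the roots:
  `nodup_map_mk_aroots` (distinct roots stay distinct modulo every maximal ideal of `S`),
  `isUnit_sub_of_mem_aroots` (`αᵢ − αⱼ` is a unit of `S`), `isUnit_aeval_derivative`
  (`f′(αⱼ) ∈ Sˣ`), `inv_aeval_derivative_mem` (`f′(αⱼ)⁻¹ ∈ S`), `aeval_derivative_ne_zero`.

Part 2 (`…SplitGaloisClosure`) concludes that `D[α₁, …, αₙ]` is finite étale over `D` and is the
integral closure of `D` in the splitting field; part 3 (`…SplitGaloisGerm`) builds `Ŝ`, the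
stabiliser action and the local-étale bundles. Everything is PROVED; no definitions, no named
facts. All statements are [folklore] (Bourbaki, *Alg. Comm.* V §2; EGA IV 18.4).

OURS (cell res-hironaka, chain W4.4); AI-written, weaker than expert review; nothing here is a
statement of the manuscript under review.
-/

noncomputable section

set_option linter.dupNamespace false

open Polynomial

namespace Summit.ResolutionOfSingularities.ResolutionOfSingularities.Theorems.NoZeno.SplittingBase

universe u

section IteratedChart

variable {R L : Type u} [CommRing R] [IsDomain R] [IsIntegrallyClosed R] [Field L] [Algebra R L]

open Literature.AlgebraicGeometry.Resolution in
/-- **Iterated étale chart of finitely many simple roots.** Let `R` be an integrally closed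
domain inside a field `L` and `p ∈ R[X]`. For every finite set `s ⊆ L` of simple roots of `p`
(`p(θ) = 0`, `p′(θ) ≠ 0`) the `R`-subalgebra of `L` generated by `s` together with the inverses
`p′(θ)⁻¹` (`θ ∈ s`) is étale over `R`: it is obtained by iterating the one-root chart
`exists_etaleChart_of_root` (each intermediate chart is again an integrally closed domain, by
`isIntegrallyClosed_of_etale`). [folklore] -/
theorem etale_adjoin_simpleRoots (hR : Function.Injective (algebraMap R L)) (p : R[X])
    (s : Finset L) (hs : ∀ θ ∈ s, aeval θ p = 0 ∧ aeval θ (derivative p) ≠ 0) :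
    Algebra.Etale R (Algebra.adjoin R ((s : Set L) ∪
      (fun θ => (aeval θ (derivative p))⁻¹) '' (s : Set L))) := by
  classical
  induction s using Finset.induction_on with
  | empty =>
    have h0 : Algebra.adjoin R (((∅ : Finset L) : Set L) ∪
        (fun θ => (aeval θ (derivative p))⁻¹) '' ((∅ : Finset L) : Set L)) = ⊥ := by
      simp
    rw [h0]
    exact Algebra.Etale.of_equiv (Algebra.botEquivOfInjective hR).symm
  | insert θ s hθs ih =>
    -- the previous chart
    set X₀ : Set L := (s : Set L) ∪ (fun θ => (aeval θ (derivative p))⁻¹) '' (s : Set L) with hX₀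
    set S : Subalgebra R L := Algebra.adjoin R X₀ with hS
    haveI hSet : Algebra.Etale R S := ih (fun x hx => hs x (Finset.mem_insert_of_mem hx))
    obtain ⟨hpθ, hpθ'⟩ := hs θ (Finset.mem_insert_self θ s)
    have hRS : Function.Injective (algebraMap R S) := by
      intro a b hab
      apply hR
      have := congrArg (fun x : S => (x : L)) hab
      simpa [Subalgebra.coe_algebraMap] using this
    haveI : IsIntegrallyClosed S := isIntegrallyClosed_of_etale hRS
    have hSL : Function.Injective (algebraMap S L) := Subtype.val_injective
    -- the one-root chart over `S`
    have hpθS : aeval θ (p.map (algebraMap R S)) = 0 := by rwa [aeval_map_algebraMap]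
    have hpθS' : aeval θ (derivative (p.map (algebraMap R S))) ≠ 0 := by
      rwa [derivative_map, aeval_map_algebraMap]
    obtain ⟨T', u, hT'et, hθT', huT', hT'eq, hu, -, -⟩ :=
      exists_etaleChart_of_root hSL (p.map (algebraMap R S)) θ hpθS hpθS'
    haveI := hT'et
    haveI : Algebra.Etale R T' := Algebra.Etale.comp R S T'
    -- `u = p′(θ)⁻¹`
    have hu' : u = (aeval θ (derivative p))⁻¹ := by
      rw [derivative_map, aeval_map_algebraMap] at hu
      exact eq_inv_of_mul_eq_one_left hu
    -- the new chart as a subalgebra over `R`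
    set X₁ : Set L := ((insert θ s : Finset L) : Set L) ∪
      (fun θ => (aeval θ (derivative p))⁻¹) '' ((insert θ s : Finset L) : Set L) with hX₁
    have hX₁eq : X₁ = X₀ ∪ {θ, u} := by
      ext x
      simp only [hX₁, hX₀, Finset.coe_insert, Set.image_insert_eq, Set.mem_union,
        Set.mem_insert_iff, Set.mem_image, Finset.mem_coe, Set.mem_singleton_iff, hu']
      constructor
      · rintro ((h | h) | h | h)
        · exact Or.inr (Or.inl h)
        · exact Or.inl (Or.inl h)
        · exact Or.inr (Or.inr h)
        · exact Or.inl (Or.inr h)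
      · rintro ((h | h) | h | h)
        · exact Or.inl (Or.inr h)
        · exact Or.inr (Or.inr h)
        · exact Or.inl (Or.inl h)
        · exact Or.inr (Or.inl h)
    have hres : (T'.restrictScalars R) = Algebra.adjoin R X₁ := by
      rw [hX₁eq, Algebra.adjoin_union_eq_adjoin_adjoin, hT'eq]
    -- transport the étale structure along the identity of carriers
    let e₀ : T' ≃ₐ[R] (T'.restrictScalars R) :=
      { toFun := fun x => ⟨x.1, x.2⟩
        invFun := fun x => ⟨x.1, x.2⟩
        left_inv := fun _ => rfl
        right_inv := fun _ => rfl
        map_mul' := fun _ _ => rfl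
        map_add' := fun _ _ => rfl
        commutes' := fun r => by
          apply Subtype.ext
          change ((algebraMap R T' r : T') : L) = ((algebraMap R (T'.restrictScalars R) r) : L)
          rw [Subalgebra.coe_algebraMap]
          rw [Subalgebra.coe_algebraMap] }
    have h1 : Algebra.Etale R (T'.restrictScalars R) := Algebra.Etale.of_equiv e₀
    exact Algebra.Etale.of_equiv (Subalgebra.equivOfEq _ _ hres)

end IteratedChart

/-! ## The roots of a monic polynomial with separable reduction

Standing data: `D` an integrally closed LOCAL domain inside a field `L` (`hinj`), `f ∈ D[X]`
monic, splitting in `L` (`hsplit`), with separable reduction `f̄ ∈ κ[X]` (`hsep`, `κ` the residue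
field of `D`); `S ⊆ L` a `D`-subalgebra, integral over `D`, containing the roots of `f`. -/

section Roots

variable {D L : Type u} [CommRing D] [IsDomain D] [IsIntegrallyClosed D] [IsLocalRing D]
  [Field L] [Algebra D L]

omit [IsDomain D] [IsIntegrallyClosed D] [IsLocalRing D] in
/-- `f` splits in any `D`-subalgebra `S ⊆ L` containing its roots. [folklore] -/
theorem splits_map_subalgebra {f : D[X]} (hsplit : (f.map (algebraMap D L)).Splits)
    (S : Subalgebra D L) (hroots : f.rootSet L ⊆ S) :
    (f.map (algebraMap D S)).Splits := by
  classical
  have hmap : (f.map (algebraMap D S)).map (algebraMap S L) = f.map (algebraMap D L) := by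
    rw [Polynomial.map_map, ← IsScalarTower.algebraMap_eq]
  refine Splits.of_splits_map_of_injective (i := algebraMap S L) Subtype.val_injective
    (by rw [hmap]; exact hsplit) fun a ha => ?_
  rw [hmap] at ha
  have ha' : a ∈ f.rootSet L := by
    rw [rootSet_def, Finset.mem_coe, Multiset.mem_toFinset]
    exact ha
  exact ⟨⟨a, hroots ha'⟩, rfl⟩

omit [IsDomain D] [IsIntegrallyClosed D] [IsLocalRing D] in
/-- The roots of `f` in `S` map onto the roots of `f` in `L`. [folklore] -/
theorem map_aroots_subalgebra {f : D[X]} (hsplit : (f.map (algebraMap D L)).Splits)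
    (S : Subalgebra D L) (hroots : f.rootSet L ⊆ S) :
    (f.aroots S).map (algebraMap S L) = f.aroots L :=
  (splits_map_subalgebra hsplit S hroots).map_aroots_algebraMap

omit [IsDomain D] [IsIntegrallyClosed D] in
/-- **Distinct roots stay distinct modulo every maximal ideal.** For `S ⊆ L` integral over the
local `D` and containing the roots of the monic `f` with separable reduction, and a maximal
ideal `𝔫 ⊆ S`: the roots of `f` in `S` are simple, and two distinct roots are incongruent
modulo `𝔫` (the reduction of `f` to the field `S/𝔫 ⊇ κ` is separable). [folklore] -/
theorem nodup_map_mk_aroots {f : D[X]} (hf : f.Monic) (hsplit : (f.map (algebraMap D L)).Splits)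
    (hsep : (f.map (IsLocalRing.residue D)).Separable) (S : Subalgebra D L)
    [Algebra.IsIntegral D S] (hroots : f.rootSet L ⊆ S) (𝔫 : Ideal S) [𝔫.IsMaximal] :
    ((f.aroots S).map (Ideal.Quotient.mk 𝔫)).Nodup := by
  classical
  -- `D → S/𝔫` kills `𝔪`, so factors through `κ`
  have hcomap : 𝔫.comap (algebraMap D S) = IsLocalRing.maximalIdeal D :=
    IsLocalRing.eq_maximalIdeal (Ideal.isMaximal_comap_of_isIntegral_of_isMaximal 𝔫)
  let g : D →+* S ⧸ 𝔫 := (Ideal.Quotient.mk 𝔫).comp (algebraMap D S)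
  have hg : ∀ a ∈ IsLocalRing.maximalIdeal D, g a = 0 := by
    intro a ha
    rw [← hcomap, Ideal.mem_comap] at ha
    change Ideal.Quotient.mk 𝔫 (algebraMap D S a) = 0
    exact Ideal.Quotient.eq_zero_iff_mem.mpr ha
  let ι : IsLocalRing.ResidueField D →+* S ⧸ 𝔫 :=
    Ideal.Quotient.lift (IsLocalRing.maximalIdeal D) g hg
  have hι : ι.comp (IsLocalRing.residue D) = g := by
    ext a; rfl
  -- the reduction of `f` to `S/𝔫` is separable
  letI : Field (S ⧸ 𝔫) := Ideal.Quotient.field 𝔫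
  have hsep' : (f.map g).Separable := by
    rw [← hι, ← Polynomial.map_map]
    exact hsep.map
  -- and it is the product of the `X - ā`
  have hprod : f.map (algebraMap D S) = ((f.aroots S).map (fun a => X - C a)).prod :=
    (splits_map_subalgebra hsplit S hroots).eq_prod_roots_of_monic (hf.map _)
  have hprod' : f.map g = (((f.aroots S).map (Ideal.Quotient.mk 𝔫)).map
      (fun a => X - C a)).prod := by
    change f.map ((Ideal.Quotient.mk 𝔫).comp (algebraMap D S)) = _
    rw [← Polynomial.map_map, hprod, Polynomial.map_multiset_prod, Multiset.map_map,
      Multiset.map_map]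
    congr 1
    apply Multiset.map_congr rfl
    intro a _
    simp
  have hroots' : (f.map g).roots = (f.aroots S).map (Ideal.Quotient.mk 𝔫) := by
    rw [hprod', roots_multiset_prod_X_sub_C]
  rw [← hroots']
  exact nodup_roots hsep'

omit [IsDomain D] [IsIntegrallyClosed D] in
/-- The roots of `f` in `S` are simple. [folklore] -/
theorem nodup_aroots_subalgebra {f : D[X]} (hf : f.Monic)
    (hsplit : (f.map (algebraMap D L)).Splits)
    (hsep : (f.map (IsLocalRing.residue D)).Separable) (S : Subalgebra D L)
    [Algebra.IsIntegral D S] (hroots : f.rootSet L ⊆ S) : (f.aroots S).Nodup := by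
  classical
  -- `S` is a nonzero ring, integral over the local `D`: it has a maximal ideal
  obtain ⟨𝔫, h𝔫⟩ := Ideal.exists_maximal S
  exact (nodup_map_mk_aroots hf hsplit hsep S hroots 𝔫).of_map _

omit [IsDomain D] [IsIntegrallyClosed D] in
/-- **Differences of distinct roots are units.** [folklore] -/
theorem isUnit_sub_of_mem_aroots {f : D[X]} (hf : f.Monic)
    (hsplit : (f.map (algebraMap D L)).Splits)
    (hsep : (f.map (IsLocalRing.residue D)).Separable) (S : Subalgebra D L)
    [Algebra.IsIntegral D S] (hroots : f.rootSet L ⊆ S) {a b : S} (ha : a ∈ f.aroots S)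
    (hb : b ∈ f.aroots S) (hab : a ≠ b) : IsUnit (a - b) := by
  classical
  by_contra hunit
  obtain ⟨𝔫, h𝔫, hmem⟩ := exists_max_ideal_of_mem_nonunits (mem_nonunits_iff.mpr hunit)
  have hnd := nodup_map_mk_aroots hf hsplit hsep S hroots 𝔫
  have hinj := Multiset.inj_on_of_nodup_map hnd
  refine hab (hinj a ha b hb ?_)
  rw [Ideal.Quotient.eq, ]
  exact hmem

omit [IsDomain D] [IsIntegrallyClosed D] in
/-- **`f′(a)` is a unit** at every root `a` of `f` in `S`. [folklore] -/
theorem isUnit_aeval_derivative {f : D[X]} (hf : f.Monic)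
    (hsplit : (f.map (algebraMap D L)).Splits)
    (hsep : (f.map (IsLocalRing.residue D)).Separable) (S : Subalgebra D L)
    [Algebra.IsIntegral D S] (hroots : f.rootSet L ⊆ S) {a : S} (ha : a ∈ f.aroots S) :
    IsUnit (aeval a (derivative f)) := by
  classical
  have hsS := splits_map_subalgebra hsplit S hroots
  have hnd := nodup_aroots_subalgebra hf hsplit hsep S hroots
  have hev : aeval a (derivative f) =
      (((f.aroots S).erase a).map (fun b => a - b)).prod := by
    rw [aeval_def, ← eval_map, ← derivative_map]
    exact hsS.eval_root_derivative (hf.map _) ha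
  rw [hev]
  -- a product of units is a unit
  have key : ∀ m : Multiset S, (∀ x ∈ m, IsUnit x) → IsUnit m.prod := by
    intro m
    induction m using Multiset.induction_on with
    | empty => intro _; rw [Multiset.prod_zero]; exact isUnit_one
    | cons x m ih =>
      intro h
      rw [Multiset.prod_cons]
      exact (h x (Multiset.mem_cons_self _ _)).mul
        (ih fun y hy => h y (Multiset.mem_cons_of_mem hy))
  refine key _ fun x hx => ?_
  obtain ⟨b, hb, rfl⟩ := Multiset.mem_map.mp hx
  have hba : b ≠ a := ((hnd.mem_erase_iff).mp hb).1
  exact isUnit_sub_of_mem_aroots hf hsplit hsep S hroots ha (Multiset.mem_of_mem_erase hb)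
    (Ne.symm hba)

omit [IsDomain D] [IsIntegrallyClosed D] in
/-- **`f′(α)⁻¹ ∈ S`** for every root `α ∈ L` of `f`. [folklore] -/
theorem inv_aeval_derivative_mem {f : D[X]} (hf : f.Monic)
    (hsplit : (f.map (algebraMap D L)).Splits)
    (hsep : (f.map (IsLocalRing.residue D)).Separable) (S : Subalgebra D L)
    [Algebra.IsIntegral D S] (hroots : f.rootSet L ⊆ S) {α : L} (hα : α ∈ f.rootSet L) :
    (aeval α (derivative f))⁻¹ ∈ S := by
  classical
  -- `α = ↑a` for a root `a` of `f` in `S`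
  have hα' : α ∈ f.aroots L := by
    rw [rootSet_def, Finset.mem_coe, Multiset.mem_toFinset] at hα
    exact hα
  rw [← map_aroots_subalgebra hsplit S hroots, Multiset.mem_map] at hα'
  obtain ⟨a, ha, rfl⟩ := hα'
  obtain ⟨v, hv⟩ := (isUnit_aeval_derivative hf hsplit hsep S hroots ha).exists_right_inv
  change (aeval (a : L) (derivative f))⁻¹ ∈ S
  have hv' : aeval (a : L) (derivative f) * (v : L) = 1 := by
    rw [Subalgebra.aeval_coe, ← Subalgebra.coe_mul, hv, Subalgebra.coe_one]
  rw [← eq_inv_of_mul_eq_one_right hv']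
  exact v.2

omit [IsDomain D] [IsIntegrallyClosed D] in
/-- `f′(α) ≠ 0` in `L` for every root `α` of `f`. [folklore] -/
theorem aeval_derivative_ne_zero {f : D[X]}
    (hf : f.Monic) (hsplit : (f.map (algebraMap D L)).Splits)
    (hsep : (f.map (IsLocalRing.residue D)).Separable) {α : L} (hα : α ∈ f.rootSet L) :
    aeval α (derivative f) ≠ 0 := by
  classical
  let S : Subalgebra D L := integralClosure D L
  have hroots : f.rootSet L ⊆ S := by
    intro β hβ
    have hβ' := (mem_rootSet'.mp hβ).2
    show IsIntegral D β
    exact ⟨f, hf, by rw [← aeval_def]; exact hβ'⟩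
  have hα' : α ∈ f.aroots L := by
    rw [rootSet_def, Finset.mem_coe, Multiset.mem_toFinset] at hα
    exact hα
  rw [← map_aroots_subalgebra hsplit S hroots, Multiset.mem_map] at hα'
  obtain ⟨a, ha, rfl⟩ := hα'
  have hu := isUnit_aeval_derivative hf hsplit hsep S hroots ha
  intro h0
  have : aeval a (derivative f) = 0 := by
    apply Subtype.val_injective
    rw [← Subalgebra.aeval_coe]; exact h0
  rw [this] at hu
  exact not_isUnit_zero hu

end Roots

end Summit.ResolutionOfSingularities.ResolutionOfSingularities.Theorems.NoZeno.SplittingBase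

end
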